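import Literature.Geometry.Manifold.DeRhamProductTests
import Literature.Geometry.Manifold.MorseHandlebodies
import Literature.AlgebraicTopology.SingularHomology.KunnethRigidity
import Literature.AlgebraicTopology.SingularHomology.CompactManifoldFiniteness
import HarnessLib

/-!
# Multiplicativity of the de Rham comparison for external products of compact manifolds

For COMPACT boundaryless `C^∞` manifolds `M` (charted on `E`) and `N` (charted on `E'`), a closed
`l`-form `β` on `N` and every class `a ∈ Hᵏ(Ω•(M))`, the two sides of `DeRhamProductDefect` agree:

  `Ψ'[π₁^* a ∧ π₂^* β] = π₁^* Ψ'[a] ⌣ π₂^♯ b_β` in `Hⁿ_{M × N}(π₁⁻¹ univ)`, `n = k + l`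

(`lhs_eq_rhs_of_compactSpace`).  Proof (Bredon (1993), Thm. V.9.5 / §VI.4, reorganised as a
rigidity argument): the difference corresponds under `Θ⁻¹` to a class `z ∈ Hⁿ(M × N; ℝ)`, which
is killed by the Künneth rigidity criterion `LerayHirsch.eq_zero_of_tests`: it dies on
`(M^{≤p}) × N` for the handlebodies `M^{≤p}`, `p ≤ k`, of `M` (`MorseHandlebodies`; the two sides
agree on `(M^{≤p}, univ)` — for `p < k` because `Hₖ(M^{≤p}) = 0`, for `p = k` by detection,
`DeRhamProductTests` — and restriction transfers this, `resH_lhs_eq_resH_rhs_of_opens`), and on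
`M × N^{<l}` (`β` is exact on the handlebody `N^{<l}`, `pullH_lhs_eq_pullH_rhs_of_opens_snd`), while
`Hᵖ(M) ↪ Hᵖ(M^{≤p})`, `H^q(N) ↪ H^q(N^{<l})` (`q < l`) and `H^{≥ l}(N^{<l}) = 0`.

Everything is proved; no named facts.

## References

* [Bredon1993] G. E. Bredon, *Topology and Geometry*, GTM 139 (1993), §V.9 Thm. V.9.5, §VI.4.
* [BottTu1982Forms] R. Bott, L. W. Tu, *Differential Forms in Algebraic Topology* (1982), §I.5, Thm. 14.28.
* [HatcherAT2002] A. Hatcher, *Algebraic Topology*, CUP 2002, §3.2 Thm. 3.16.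
-/

noncomputable section

-- see "Implementation notes" in `…SingularHomology.SingularChainsConcrete`
set_option backward.isDefEq.respectTransparency false

open scoped Manifold ContDiff Topology
open CategoryTheory Limits Set Function Literature.AlgebraicTopology.SingularHomology Literature.Geometry.Kaehler

namespace Literature.Geometry.Manifold

/-! ### Topological preliminaries -/

/-- The cohomology of an empty space vanishes. [folklore] -/
theorem subsingleton_singularCohomology_of_isEmpty (F : Type) [Field F] (X : Type) [TopologicalSpace X] [IsEmpty X]
    (q : ℕ) : Subsingleton (singularCohomology F F X q) := by
  haveI : IsEmpty (SingularSimplex X q) :=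
    ⟨fun σ ↦ isEmptyElim (SingularSimplex.toContinuousMap σ (Classical.arbitrary _))⟩
  haveI : Subsingleton ((singularCochainComplex F F X).X q) := inferInstanceAs (Subsingleton (SingularSimplex X q → F))
  refine ⟨fun a b ↦ ?_⟩
  obtain ⟨x, hx, rfl⟩ := homologyCls_surjective (K := singularCochainComplex F F X) (i := q) a
  obtain ⟨y, hy, rfl⟩ := homologyCls_surjective (K := singularCochainComplex F F X) (i := q) b
  exact homologyCls_congr (Subsingleton.elim x y) _ _

/-- A subsingleton module is finite. [folklore] -/
theorem moduleFinite_of_subsingleton (F : Type) [Field F] (V : Type) [AddCommGroup V] [Module F V] [Subsingleton V] :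
    Module.Finite F V := by
  rw [Module.finite_def, Subsingleton.elim (⊤ : Submodule F V) ⊥]
  exact Submodule.fg_bot

/-- **The homology of a compact manifold charted on a finite-dimensional normed space is
finite-dimensional** (the tree's `finite_singularHomology_of_compact_chartedSpace` after
re-charting on `ℝᵈ`). [cite: HatcherAT2002, App. A Cor. A.8 and A.9 p. 527] -/
theorem finite_singularHomology_of_compact_normedCharts (F : Type) [Field F] (E : Type) [NormedAddCommGroup E]
    [NormedSpace ℝ E] [FiniteDimensional ℝ E] (M : Type) [TopologicalSpace M] [ChartedSpace E M] [T2Space M]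
    [CompactSpace M] (q : ℕ) : Module.Finite F (singularHomology F F M q) := by
  let L : E ≃L[ℝ] EuclideanSpace ℝ (Fin (Module.finrank ℝ E)) :=
    ContinuousLinearEquiv.ofFinrankEq (by rw [finrank_euclideanSpace_fin])
  haveI : CompactSpace (Rechart L.toHomeomorph M) := ‹CompactSpace M›
  haveI : T2Space (Rechart L.toHomeomorph M) := ‹T2Space M›
  haveI h := finite_singularHomology_of_compact_chartedSpace F F (X := Rechart L.toHomeomorph M)
    (d := Module.finrank ℝ E) q
  exact Module.Finite.of_injective _ (injective_map_homeomorph F F (Rechart.outHomeomorph L.toHomeomorph M).symm q)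

/-- The vanishing of the cohomology of a compact manifold above its dimension, and of all positive
degrees in dimension `0` (through Kronecker duality). [cite: Milnor1963, Thm. 3.5 and §5] -/
theorem subsingleton_singularCohomology_of_finrank_lt (E : Type) [NormedAddCommGroup E] [NormedSpace ℝ E]
    [FiniteDimensional ℝ E] (M : Type) [TopologicalSpace M] [ChartedSpace E M] [IsManifold 𝓘(ℝ, E) ∞ M] [T2Space M]
    [CompactSpace M] {j : ℕ} (hj : Module.finrank ℝ E < j) : Subsingleton (singularCohomology ℝ ℝ M j) := by
  refine subsingleton_singularCohomology_of_isZero ℝ M j ?_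
  rcases Nat.eq_zero_or_pos (Module.finrank ℝ E) with h0 | hpos
  · haveI := NaturalCohomologyEndo.subsingleton_singularHomology_of_finrank_eq_zero E ℝ h0 M (j := j) (by omega)
    exact ModuleCat.isZero_of_subsingleton _
  · obtain ⟨d, hd⟩ : ∃ d, Module.finrank ℝ E = d + 1 := ⟨Module.finrank ℝ E - 1, by omega⟩
    haveI := NaturalCohomologyEndo.subsingleton_singularHomology_of_finrank_lt E ℝ hd M (j := j) (by omega)
    exact ModuleCat.isZero_of_subsingleton _

/-! ### The setting: two compact manifolds -/

variable {E : Type} [NormedAddCommGroup E] [NormedSpace ℝ E] [FiniteDimensional ℝ E]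
  {M : Type} [TopologicalSpace M] [ChartedSpace E M] [IsManifold 𝓘(ℝ, E) ∞ M] [T2Space M] [CompactSpace M]
  [SecondCountableTopology M] [LocallyCompactSpace M]
  {E' : Type} [NormedAddCommGroup E'] [NormedSpace ℝ E'] [FiniteDimensional ℝ E']
  {N : Type} [TopologicalSpace N] [ChartedSpace E' N] [IsManifold 𝓘(ℝ, E') ∞ N] [T2Space N] [CompactSpace N]
  [SecondCountableTopology N] [LocallyCompactSpace N]
  {k l n : ℕ}

omit [IsManifold 𝓘(ℝ, E) ∞ M] [T2Space M] [CompactSpace M] [SecondCountableTopology M] [LocallyCompactSpace M]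
  [IsManifold 𝓘(ℝ, E') ∞ N] [T2Space N] [CompactSpace N] [SecondCountableTopology N] [LocallyCompactSpace N]
  [FiniteDimensional ℝ E] [FiniteDimensional ℝ E'] [ChartedSpace E M] [ChartedSpace E' N] in
/-- A class of `Hⁿ(M × N; ℝ)` underlying an element of `Hⁿ_{M × N}(π₁⁻¹ univ)` (through `Θ⁻¹` and the
restriction `π₁⁻¹ univ ⊆ univ`). [folklore] -/
theorem exists_resH_thetaInv_eq (T : (subsetCochains ℝ realCoeff.{0} (Prod.fst ⁻¹' (univ : Set M) : Set (M × N))).homology n) :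
    ∃ z : singularCohomology ℝ ℝ (M × N) n,
      subsetCochains.resH (N := realCoeff.{0}) (subset_univ _) n (subsetCochains.thetaInv n z) = T := by
  obtain ⟨z, hz⟩ := thetaInv_surjective (M := M × N) (k := n)
    (subsetCochains.resH (N := realCoeff.{0}) (fun _ _ ↦ mem_univ _ : (univ : Set (M × N)) ⊆ Prod.fst ⁻¹' univ) n T)
  refine ⟨z, ?_⟩
  rw [hz, ← ModuleCat.comp_apply, ← HomologicalComplex.homologyMap_comp, ← subsetCochains.res_comp]
  exact subsetCochains.resH_refl_apply _ n T

omit [IsManifold 𝓘(ℝ, E) ∞ M] [T2Space M] [CompactSpace M] [SecondCountableTopology M] [LocallyCompactSpace M]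
  [IsManifold 𝓘(ℝ, E') ∞ N] [T2Space N] [CompactSpace N] [SecondCountableTopology N] [LocallyCompactSpace N]
  [FiniteDimensional ℝ E] [FiniteDimensional ℝ E'] [ChartedSpace E M] [ChartedSpace E' N] in
/-- **First-factor transfer to singular cohomology**: if the restriction of `Θ⁻¹ z` to `π₁⁻¹ U`
vanishes, then `(val × id)^* z = 0` on `↥U × N` (restriction along `↥(π₁⁻¹ U) → M × N` kills `z`,
`resH_thetaInv_eq_zero_iff`, and `↥U × N → ↥(π₁⁻¹ U)` is a continuous section over `M × N`). [folklore] -/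
theorem map_prodMap_eq_zero_of_resH_thetaInv_eq_zero (U : Set M) (z : singularCohomology ℝ ℝ (M × N) n)
    (hz : subsetCochains.resH (N := realCoeff.{0}) (subset_univ (Prod.fst ⁻¹' U : Set (M × N))) n
      (subsetCochains.thetaInv n z) = 0) :
    singularCohomology.map ℝ ℝ
      ((⟨Subtype.val, continuous_subtype_val⟩ : C(↥U, M)).prodMap (ContinuousMap.id N)) n z = 0 := by
  rw [subsetCochains.resH_thetaInv_eq_zero_iff] at hz
  let ψ : C(↥U × N, ↥(Prod.fst ⁻¹' U : Set (M × N))) :=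
    ⟨fun p ↦ ⟨(p.1.1, p.2), p.1.2⟩, by fun_prop⟩
  have hfac : (⟨Subtype.val, continuous_subtype_val⟩ : C(↥U, M)).prodMap (ContinuousMap.id N) =
      (⟨Subtype.val, continuous_subtype_val⟩ : C(↥(Prod.fst ⁻¹' U : Set (M × N)), M × N)).comp ψ := by
    ext p <;> rfl
  rw [hfac, singularCohomology.map_comp, ModuleCat.comp_apply, hz, map_zero]

omit [IsManifold 𝓘(ℝ, E) ∞ M] [T2Space M] [CompactSpace M] [SecondCountableTopology M] [LocallyCompactSpace M]
  [IsManifold 𝓘(ℝ, E') ∞ N] [T2Space N] [CompactSpace N] [SecondCountableTopology N] [LocallyCompactSpace N]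
  [FiniteDimensional ℝ E] [FiniteDimensional ℝ E'] [ChartedSpace E M] [ChartedSpace E' N] in
/-- **Second-factor transfer to singular cohomology**: if the pull-back along `j : Y → M × N`
(from `π₁⁻¹ univ ⊆ Y` to `π₁⁻¹ univ ⊆ M × N`) of the restriction of `Θ⁻¹ z` vanishes, then
`j^* z = 0` (bridges `hom_pullH`, `hom_resH`, `hom_thetaInv`, and the continuous section
`Y → ↥(π₁⁻¹ univ)`). [folklore] -/
theorem map_eq_zero_of_pullH_resH_thetaInv_eq_zero {P : Type} [TopologicalSpace P] (j : C(M × P, M × N))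
    (hj : MapsTo j (Prod.fst ⁻¹' (univ : Set M) : Set (M × P)) (Prod.fst ⁻¹' (univ : Set M) : Set (M × N)))
    (z : singularCohomology ℝ ℝ (M × N) n)
    (hz : subsetCochains.pullH (N := realCoeff.{0}) j hj n
      (subsetCochains.resH (N := realCoeff.{0}) (subset_univ (Prod.fst ⁻¹' (univ : Set M) : Set (M × N))) n
        (subsetCochains.thetaInv n z)) = 0) :
    singularCohomology.map ℝ ℝ j n z = 0 := by
  have h := congrArg (subsetCochains.homologyIsoSingularCohomology ℝ (Prod.fst ⁻¹' (univ : Set M) : Set (M × P)) n).hom hz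
  rw [map_zero, subsetCochains.homologyIsoSingularCohomology_hom_pullH, subsetCochains.homologyIsoSingularCohomology_hom_resH,
    subsetCochains.homologyIsoSingularCohomology_hom_thetaInv, ← ModuleCat.comp_apply, ← ModuleCat.comp_apply,
    ← singularCohomology.map_comp, ← singularCohomology.map_comp] at h
  -- the composite `↥(π₁⁻¹ univ) → M × N` is `j ∘ val`; precompose with the section
  let s : C(M × P, ↥(Prod.fst ⁻¹' (univ : Set M) : Set (M × P))) := ⟨fun p ↦ ⟨p, mem_univ _⟩, by fun_prop⟩
  have hfac : j = ((⟨Subtype.val, continuous_subtype_val⟩ : C(↥(univ : Set (M × N)), M × N)).comp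
      ((ContinuousMap.inclusion (subset_univ (Prod.fst ⁻¹' (univ : Set M) : Set (M × N)))).comp
        (subsetCochains.restrictMap j hj))).comp s := by
    ext p <;> rfl
  rw [hfac, singularCohomology.map_comp, ModuleCat.comp_apply, h, map_zero]

/-! ### The theorem -/

/-- **The two sides agree for compact manifolds**: for compact boundaryless `M`, `N`, a closed
`l`-form `β` on `N` and `a ∈ Hᵏ(Ω•(M))`,
`Ψ'_{π₁⁻¹ univ}[π₁^* a ∧ π₂^* β] = π₁^* Ψ'_M[a] ⌣ π₂^♯ b_β`.
[cite: Bredon1993, Thm. V.9.5] [cite: BottTu1982Forms, §I.5] -/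
theorem lhs_eq_rhs_of_compactSpace (β : closedSmoothForms 𝓘(ℝ, E') N ℝ l) (h : k + l = n)
    (a : (localDeRhamComplex 𝓘(ℝ, E) ℝ (isOpen_univ : IsOpen (univ : Set M))).homology k) :
    lhs N isOpen_univ β k n h a = rhs N isOpen_univ β k n h a := by
  classical
  -- ### trivial cases
  by_cases hkM : Subsingleton (singularCohomology ℝ ℝ M k)
  · exact lhs_eq_rhs_of_subsingleton β h a
  by_cases hlN : Subsingleton (singularCohomology ℝ ℝ N l)
  · exact lhs_eq_rhs_of_subsingleton_snd isOpen_univ β h a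
  rcases Nat.eq_zero_or_pos k with rfl | hk1
  · exact lhs_eq_rhs_of_degree_zero isOpen_univ β h a
  -- dimensions
  have hkE : k ≤ Module.finrank ℝ E := le_of_not_gt fun hlt ↦ hkM (subsingleton_singularCohomology_of_finrank_lt E M hlt)
  have hlE : l ≤ Module.finrank ℝ E' := le_of_not_gt fun hlt ↦ hlN (subsingleton_singularCohomology_of_finrank_lt E' N hlt)
  obtain ⟨dM, hdM⟩ : ∃ dM, Module.finrank ℝ E = dM + 1 := ⟨Module.finrank ℝ E - 1, by omega⟩
  have hkd : k ≤ dM + 1 := hdM ▸ hkE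
  -- ### the difference of the two sides and its class `z ∈ Hⁿ(M × N; ℝ)`
  set T := lhs N isOpen_univ β k n h a - rhs N isOpen_univ β k n h a with hT
  obtain ⟨z, hz⟩ := exists_resH_thetaInv_eq (M := M) (N := N) T
  suffices hz0 : z = 0 by
    have hT0 : T = 0 := by rw [← hz, hz0, map_zero, map_zero]
    exact sub_eq_zero.1 hT0
  -- ### graded bases of `H*(N; ℝ)`
  set D : ℕ := n + Module.finrank ℝ E' with hDdef
  have hDvan : ∀ q, D < q → Subsingleton (singularCohomology ℝ ℝ N q) := fun q hq ↦
    subsingleton_singularCohomology_of_finrank_lt E' N (by omega)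
  haveI hfinN : ∀ q, Module.Finite ℝ (singularCohomology ℝ ℝ N q) := fun q ↦ by
    haveI := finite_singularHomology_of_compact_normedCharts ℝ E' N q
    exact finite_singularCohomology_of_finite ℝ N q
  let σN : Fin (D + 1) → Type := fun q ↦ Fin (Module.finrank ℝ (singularCohomology ℝ ℝ N q))
  let vN : (q : Fin (D + 1)) → σN q → singularCohomology ℝ ℝ N q := fun q ↦ Module.finBasis ℝ _
  have hvN : ∀ q, Bijective fun r : σN q → ℝ ↦ ∑ i, r i • vN q i := by
    intro q
    have : (fun r : σN q → ℝ ↦ ∑ i, r i • vN q i) = (Module.finBasis ℝ (singularCohomology ℝ ℝ N q)).equivFun.symm :=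
      funext fun r ↦ ((Module.finBasis ℝ (singularCohomology ℝ ℝ N q)).equivFun_symm_apply r).symm
    rw [this]
    exact (Module.finBasis ℝ (singularCohomology ℝ ℝ N q)).equivFun.symm.bijective
  -- ### the first-factor tests: handlebodies of `M`
  obtain ⟨U, hUmono, hUinj, hUvan, hUfin, hUdet⟩ := exists_handlebodies ℝ hdM M
  haveI : ∀ p, LocallyCompactSpace ↥(U p) := fun p ↦ (U p).isOpen.locallyCompactSpace
  let jU : ∀ p, C(↥(U p), M) := fun p ↦ ⟨Subtype.val, continuous_subtype_val⟩
  have hUinj' : ∀ p ≤ k, Injective (singularCohomology.map ℝ ℝ (jU p) p) := fun p _ ↦ hUinj p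
  have hUz : ∀ p ≤ k, singularCohomology.map ℝ ℝ ((jU p).prodMap (ContinuousMap.id N)) n z = 0 := by
    intro p hp
    apply map_prodMap_eq_zero_of_resH_thetaInv_eq_zero
    -- the two sides agree on `(↥(U p), univ)`
    have hagree : ∀ a' : (localDeRhamComplex 𝓘(ℝ, E) ℝ (isOpen_univ : IsOpen (univ : Set ↥(U p)))).homology k,
        lhs N isOpen_univ β k n h a' = rhs N isOpen_univ β k n h a' := by
      rcases lt_or_eq_of_le hp with hlt | rfl
      · haveI : Subsingleton (singularCohomology ℝ ℝ ↥(U p) k) :=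
          subsingleton_singularCohomology_of_isZero ℝ _ k (hUvan p k hlt)
        exact fun a' ↦ lhs_eq_rhs_of_subsingleton β h a'
      · haveI : Module.Finite ℝ (singularHomology ℝ ℝ ↥(U p) p) := hUfin p p
        refine fun a' ↦ lhs_eq_rhs_of_detect (fun σ hσ ↦ ?_) β h a'
        obtain ⟨γ, hγ⟩ := hUdet p hk1 hkd σ hσ
        obtain ⟨G, hG, hG0, hdetG⟩ := exists_contMDiff_punctured_detect (E := E) ℝ ↥(U p) γ
        exact ⟨G, hG, hG0, hdetG p σ hγ⟩
    have hres := resH_lhs_eq_resH_rhs_of_opens (U p) β h hagree a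
    have hT0 : subsetCochains.resH (N := realCoeff.{0}) (preimage_mono (subset_univ (U p : Set M))) n T = 0 := by
      rw [hT, map_sub, hres, sub_self]
    rw [← hz, ← ModuleCat.comp_apply, ← HomologicalComplex.homologyMap_comp, ← subsetCochains.res_comp] at hT0
    exact hT0
  -- ### the second-factor test and the conclusion
  cases l with
  | zero =>
    -- `l = 0`: all Künneth components have base degree `≤ k`; the empty space serves as `V`
    haveI hE : ∀ q, Subsingleton (singularCohomology ℝ ℝ ↥(∅ : Set N) q) := fun q ↦
      subsingleton_singularCohomology_of_isEmpty ℝ _ q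
    haveI : Subsingleton (singularCohomology ℝ ℝ (M × ↥(∅ : Set N)) n) := subsingleton_singularCohomology_of_isEmpty ℝ _ n
    exact LerayHirsch.eq_zero_of_tests ℝ E vN hvN hDvan h (by omega) z (fun p ↦ ↥(U p)) jU hUinj' hUz
      (⟨Subtype.val, continuous_subtype_val⟩ : C(↥(∅ : Set N), N)) (fun q hq ↦ absurd hq (Nat.not_lt_zero _))
      (fun q _ ↦ hE q) (fun q ↦ moduleFinite_of_subsingleton ℝ _) (Subsingleton.elim _ _)
  | succ l' =>
    -- `l = l' + 1`: the handlebody `V = N^{≤ l'}` of `N`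
    obtain ⟨dN, hdN⟩ : ∃ dN, Module.finrank ℝ E' = dN + 1 := ⟨Module.finrank ℝ E' - 1, by omega⟩
    obtain ⟨UN, hNmono, hNinj, hNvan, hNfin, -⟩ := exists_handlebodies ℝ hdN N
    haveI : LocallyCompactSpace ↥(UN l') := (UN l').isOpen.locallyCompactSpace
    let jV : C(↥(UN l'), N) := ⟨Subtype.val, continuous_subtype_val⟩
    have hVinj : ∀ q : Fin (D + 1), (q : ℕ) < l' + 1 → Injective (singularCohomology.map ℝ ℝ jV q) := by
      intro q hq x y hxy
      have hle : UN q ≤ UN l' := hNmono q l' (by omega)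
      let incl : C(↥(UN q), ↥(UN l')) := ⟨fun u ↦ ⟨u.1, hle u.2⟩, by fun_prop⟩
      have hfac : (⟨Subtype.val, continuous_subtype_val⟩ : C(↥(UN q), N)) = jV.comp incl := by
        ext u
        rfl
      apply hNinj q
      change singularCohomology.map ℝ ℝ (⟨Subtype.val, continuous_subtype_val⟩ : C(↥(UN q), N)) q x =
        singularCohomology.map ℝ ℝ (⟨Subtype.val, continuous_subtype_val⟩ : C(↥(UN q), N)) q y
      rw [hfac, singularCohomology.map_comp, ModuleCat.comp_apply, ModuleCat.comp_apply, hxy]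
    have hVvan : ∀ q, l' + 1 ≤ q → Subsingleton (singularCohomology ℝ ℝ ↥(UN l') q) := fun q hq ↦
      subsingleton_singularCohomology_of_isZero ℝ _ q (hNvan l' q (by omega))
    have hVfin : ∀ q, Module.Finite ℝ (singularCohomology ℝ ℝ ↥(UN l') q) := fun q ↦ by
      haveI := hNfin l' q
      exact finite_singularCohomology_of_finite ℝ _ q
    have hVz : singularCohomology.map ℝ ℝ ((ContinuousMap.id M).prodMap jV) n z = 0 := by
      haveI := hVvan (l' + 1) le_rfl
      have hval : ContMDiff 𝓘(ℝ, E') 𝓘(ℝ, E') ∞ (Subtype.val : ↥(UN l') → N) := contMDiff_subtype_val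
      have hpull := pullH_lhs_eq_pullH_rhs_of_opens_snd (M := M) (UN l') isOpen_univ β h a
      have hT0 : subsetCochains.pullH (N := realCoeff.{0}) (idProdMapCM (M := M) hval)
          (mapsTo_id_prodMap (Subtype.val : ↥(UN l') → N) (univ : Set M)) n T = 0 := by
        rw [hT, map_sub, sub_eq_zero]
        exact hpull
      rw [← hz] at hT0
      exact map_eq_zero_of_pullH_resH_thetaInv_eq_zero (idProdMapCM (M := M) hval) _ z hT0
    exact LerayHirsch.eq_zero_of_tests ℝ E vN hvN hDvan h (by omega) z (fun p ↦ ↥(U p)) jU hUinj' hUz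
      jV hVinj hVvan hVfin hVz

end Literature.Geometry.Manifold
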